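import Summits.BirchSwinnertonDyer.BirchSwinnertonDyer.Theorems.SignedLowerHalvesSmallImageLowerHalfBothSignsRttLayerLawUndepleted
import Summits.BirchSwinnertonDyer.BirchSwinnertonDyer.Theorems.ResidualThetaTransportAtTwoResidualThetaMainConjectureAtTwoAnalyticLayerLawKAtTwo
import Summits.BirchSwinnertonDyer.BirchSwinnertonDyer.Theorems.ResidualThetaTransportAtTwoResidualThetaMainConjectureAtTwoPollackLayerK
import Literature.NumberTheory.EllipticCurves.SharpFlatPAdicLFunctionCoeffField
import HarnessLib

/-!
# Route `SignedLowerHalves`, crux L `SmallImageLowerHalfBothSigns` (item stmt-BirchSwinnertonDyer-23599), line `rtt_w3` —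
# the PARTNER-side analytic layer law over `𝒪` (brick AN_g of the engine ENG / ENG_T2), part 1: UNDEPLETED core at every
# prime `p` and both parities — `λ_n(θ_n(g)^ι) = deg ω_n^{−ε} + d(L^ε)` inside the headroom

Width seat `bsd-line-slh-p3-w3` g12 under LEAD `cruxlead-stmt-BirchSwinnertonDyer-23599` (cell `bsd-ssimc`); ROUTE-INDEPENDENT
helper (`--supports stmt-BirchSwinnertonDyer-23599`); THEOREMS ONLY — no definition, no named fact, no `sorry`; closes nothing;
BSD is not proved by any of this.

WHAT. The registered engine stub ENG `stub_partnerLayerLambdaLower_ns` (v3; v4: ENG_T2) of line `rtt_w3` bounds the layer-`λ` of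
the `S₀`-depleted Mazur–Tate element `θ^{S₀}_n(g)^ι` of the level-matched CM PARTNER `g` (a weight-2 newform with Hecke field
`K_g`, read in `ℚ̄_p` along `ι : K_g → ℚ̄_p`). The LEAD's census (CENSUS-Klam2-g0 §2) cuts its proof into (M4) the analytic layer law
for `g` over `𝒪 = 𝒪_{ℚ_p(ι K_g)}` ∧ (M3^≥) the partner's signed main conjecture (lower half) ∧ (M2) the algebraic `λ`-transfer.
This file is the `S₀ = ∅` CORE of (M4) — the `𝒪`-coefficient twin of the LEAD's rational
`SmallImageRttOneSided.layerLambda_mazurTateElement_of_isPollackPair` (p742508) and the every-prime / both-parities form of the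
tree's `p = 2` reading `ResidualThetaLayer.stub_analyticLayerLawKAtTwo` (R1b of route `ResidualThetaTransportAtTwo`):
for a Pollack pair `(L⁺, L⁻) ∈ 𝒪⟦T⟧²` of `g` along `ι` relative to a period `Ω` (`IsPollackPairK g ι Ω L⁺ L⁻`, Pollack 2003
Prop. 6.18 over `𝒪`), a sign `ε` (Kobayashi's labelling `kobayashiLK`: `ε = 1 ↔` even `n ↔ L⁻, ω_n^-`), and the NORM-`λ` datum
`d` of `L^ε` (its Gauss norm `s` is first attained at the index `d`; no `μ = 0` hypothesis), at every layer `n` of the parity of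
`ε` inside the headroom `deg ω_n^{−ε} + d < pⁿ`:
`‖θ_n(g)^ι‖_sup = s` and `λ_n(θ_n(g)^ι) = deg ω_n^{−ε} + d` (`λ_n` = Pollack–Weston's `layerLambda`).

HOW. Norm language throughout (`ResidualThetaLayer.supNorm_eq_and_layerLambda_eq_of_layerCongruence`, the tree's coefficient-norm
form of the integral-model lemma, valid for the ring of integers of any closed subfield of `ℚ̄_p`): the modulus
`ω_n = (X+1)^{pⁿ} − 1` has leading coefficient `1` and all other coefficients of norm `≤ p⁻¹`
(`ResidualThetaLayer.coeff_map_cyclotomicOmega_norm`, any `p`), and the signed half-modulus `(−1)^{⌊n/2⌋+1} ω_n^∓` has ONE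
coefficient of norm `1`, in degree `deg ω_n^∓`, all others of norm `≤ p⁻¹` — from the LEAD's reductions
`ω_n^± ≡ X^{deg ω_n^±} (mod p)` (`SmallImageRttOneSided.map_zmod_cyclotomicOmegaPlus/Minus`), §1 below.

* §1 `coeff_map_norm_of_map_zmod_eq_C_mul_X_pow` — an integer polynomial with reduction `u·X^D` (`u ≠ 0`) has, read in `ℚ̄_p`,
  a coefficient of norm `1` in degree `D` and all others of norm `≤ p⁻¹`; `coeff_map_signedOmega_norm` — the case of
  `(−1)^e ω_n^{−ε}`.
* §2 `supNorm_eq_and_layerLambda_mazurTateElementK_of_isPollackPairK` — the law at one layer inside the headroom;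
  `eventually_layerLambda_mazurTateElementK_of_isPollackPairK` — for all `n ≥ 2d + 2` of the parity of `ε`.
* §3 `exists_normLambda_of_hasUnitContent` — unit content of `L ∈ 𝒪⟦T⟧` (`HasUnitContent`, `μ = 0`) supplies the datum `d` with
  `s = 1` (so the law reads `μ_n(θ_n(g)^ι) = 0`, `λ_n = deg ω_n^{−ε} + d`).

References: [Pollack2003] Prop. 6.18, Prop. 6.9, §6.5; [PollackWeston2011MT] §3.1, Thm. 4.1 (`𝒪`-coefficients, `q_n = deg ω_n^{−ε}`);
[Kobayashi2003] (3.6); [Washington1997] §7.1.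
-/

set_option autoImplicit false
-- D-0017: single-problem summit, the namespace repeats the problem name by design.
set_option linter.dupNamespace false
noncomputable section

open scoped Classical MatrixGroups ModularForm

open Polynomial Literature.NumberTheory.EllipticCurves Literature.NumberTheory.EllipticCurves.ModularForms
  Literature.NumberTheory.EllipticCurves.GreenbergVatsal2000 Literature.NumberTheory.IwasawaTheory
  Summit.BirchSwinnertonDyer.BirchSwinnertonDyer.Theorems.ResidualThetaLayer
  Summit.BirchSwinnertonDyer.BirchSwinnertonDyer.Theorems.SmallImageRttOneSided

namespace Summit.BirchSwinnertonDyer.BirchSwinnertonDyer.Theorems.SmallImageRttLayerLawK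

variable {p : ℕ} [hp : Fact p.Prime]

/-! ## §1 Integer polynomials with monomial reduction, read in `ℚ̄_p` -/

section Monomial

/-- The norm of an integer read in `ℚ̄_p` is its `p`-adic norm. [folklore] -/
theorem norm_intCast_padicAlgCl (z : ℤ) : ‖((z : ℤ) : PadicAlgCl p)‖ = ‖(z : ℤ_[p])‖ := by
  rw [← map_intCast ((algebraMap ℚ_[p] (PadicAlgCl p)).comp (algebraMap ℤ_[p] ℚ_[p])) z,
    norm_algebraMap_comp_padicInt]

/-- **An integer polynomial whose reduction mod `p` is a monomial `u·X^D` (`u ≠ 0`) has, read in `ℚ̄_p`, a coefficient of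
norm `1` in degree `D` and all other coefficients of norm `≤ p⁻¹`.** [folklore] -/
theorem coeff_map_norm_of_map_zmod_eq_C_mul_X_pow {ω : ℤ[X]} {u : ZMod p} (hu : u ≠ 0) {D : ℕ}
    (hω : ω.map (Int.castRingHom (ZMod p)) = C u * X ^ D) :
    ‖(ω.map (Int.castRingHom (PadicAlgCl p))).coeff D‖ = 1 ∧
      ∀ j, j ≠ D → ‖(ω.map (Int.castRingHom (PadicAlgCl p))).coeff j‖ ≤ (p : ℝ)⁻¹ := by
  have hcoeffbar : ∀ j, (Int.castRingHom (ZMod p)) (ω.coeff j) = if j = D then u else 0 := by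
    intro j
    rw [← Polynomial.coeff_map, hω, coeff_C_mul_X_pow]
  have hcoeffK : ∀ j, (ω.map (Int.castRingHom (PadicAlgCl p))).coeff j = ((ω.coeff j : ℤ) : PadicAlgCl p) := by
    intro j; rw [Polynomial.coeff_map, eq_intCast]
  refine ⟨?_, fun j hj ↦ ?_⟩
  · rw [hcoeffK, norm_intCast_padicAlgCl]
    have h1 : ¬ (p : ℤ) ∣ ω.coeff D := by
      intro h2
      have h3 := hcoeffbar D
      rw [if_pos rfl, eq_intCast, (ZMod.intCast_zmod_eq_zero_iff_dvd _ p).mpr h2] at h3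
      exact hu h3.symm
    have h4 : ¬ ‖(ω.coeff D : ℤ_[p])‖ < 1 := fun h ↦ h1 ((PadicInt.norm_int_lt_one_iff_dvd _).mp h)
    exact le_antisymm (PadicInt.norm_le_one _) (not_lt.mp h4)
  · rw [hcoeffK, norm_intCast_padicAlgCl]
    have h2 : (p : ℤ) ∣ ω.coeff j := by
      have h3 := hcoeffbar j
      rw [if_neg hj, eq_intCast, ZMod.intCast_zmod_eq_zero_iff_dvd] at h3
      exact h3
    obtain ⟨w, hw⟩ := h2
    rw [hw, Int.cast_mul, norm_mul, Int.cast_natCast]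
    calc ‖((p : ℕ) : ℤ_[p])‖ * ‖(w : ℤ_[p])‖ ≤ (p : ℝ)⁻¹ * 1 :=
          mul_le_mul (PadicInt.norm_p (p := p)).le (PadicInt.norm_le_one _) (norm_nonneg _)
            (inv_nonneg.mpr (Nat.cast_nonneg _))
      _ = (p : ℝ)⁻¹ := mul_one _

/-- **The signed half-modulus in norm language** (any prime `p`, any sign exponent `e`): `((−1)^e ω_n^{−ε}).map ℤ→ℚ̄_p`, where
`ω_n^{−ε} = ω_n^-` if `ε = 1` and `ω_n^+` otherwise, has a coefficient of norm `1` in degree `deg ω_n^{−ε}` and all other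
coefficients of norm `≤ p⁻¹` (`ω_n^± ≡ X^{deg ω_n^±} (mod p)`). [cite: Pollack2003, §6.5 (display before Prop. 6.18)] -/
theorem coeff_map_signedOmega_norm (ε : ℤˣ) (n e : ℕ) :
    ‖(((-1) ^ e * (if ε = 1 then cyclotomicOmegaMinus p n else cyclotomicOmegaPlus p n)).map
        (Int.castRingHom (PadicAlgCl p))).coeff
        (if ε = 1 then cyclotomicOmegaMinus p n else cyclotomicOmegaPlus p n).natDegree‖ = 1 ∧
      ∀ j, j ≠ (if ε = 1 then cyclotomicOmegaMinus p n else cyclotomicOmegaPlus p n).natDegree →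
        ‖(((-1) ^ e * (if ε = 1 then cyclotomicOmegaMinus p n else cyclotomicOmegaPlus p n)).map
          (Int.castRingHom (PadicAlgCl p))).coeff j‖ ≤ (p : ℝ)⁻¹ := by
  have hu : ((-1 : ZMod p) ^ e) ≠ 0 := pow_ne_zero _ (neg_ne_zero.mpr one_ne_zero)
  refine coeff_map_norm_of_map_zmod_eq_C_mul_X_pow hu (map_zmod_neg_one_pow_mul ?_ e)
  split_ifs
  · exact map_zmod_cyclotomicOmegaMinus n
  · exact map_zmod_cyclotomicOmegaPlus n

end Monomial

/-! ## §2 The undepleted layer law for a Pollack pair over `𝒪` -/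

section Core

variable {M : ℕ} (g : CuspForm (CongruenceSubgroup.Gamma0 M) 2)
  (ι : coeffField g →+* PadicAlgCl p) (Ω : ℂ)

/-- **`‖θ_n(g)^ι‖_sup = s` and `λ_n(θ_n(g)^ι) = deg ω_n^{−ε} + d` at a layer of the parity of `ε` inside the headroom.** For a
weight-2 cusp form `g` on `Γ₀(M)`, an embedding `ι : K_g → ℚ̄_p`, a period `Ω`, a Pollack pair `(L⁺, L⁻) ∈ 𝒪⟦T⟧²` of `g` along
`ι` (`IsPollackPairK g ι Ω L⁺ L⁻`), a sign `ε` and an index `d` at which the Gauss norm `s` of `L^ε = kobayashiLK ε L⁺ L⁻` is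
FIRST attained (`‖L^ε_k‖ ≤ ‖L^ε_d‖` for all `k`, `<` for `k < d`): if `Even n ↔ ε = 1` and `deg ω_n^{−ε} + d < pⁿ` then the
Mazur–Tate element `θ_n(g)^ι = (mazurTateElementK g Ω p n).map ι ∈ ℚ̄_p[X]` has sup norm `s = ‖L^ε_d‖` and layer-`λ` equal to
`deg ω_n^{−ε} + d` (Pollack's Prop. 6.18 congruence `p^m(θ_n − (−1)^{⌊n/2⌋+1} ω_n^{−ε} L^ε) = ω_n·q`, `q ∈ 𝒪⟦T⟧`, read
coefficientwise in norms). [cite: Pollack2003, Prop. 6.18 and Prop. 6.9] [cite: PollackWeston2011MT, §3.1 and Thm. 4.1] -/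
theorem supNorm_eq_and_layerLambda_mazurTateElementK_of_isPollackPairK
    {Lplus Lminus : IwasawaAlgebraO (Set.range ι)} (hPK : IsPollackPairK g ι Ω Lplus Lminus) (ε : ℤˣ) {d : ℕ}
    (hd1 : ∀ k : ℕ, ‖PowerSeries.coeff k (iwasawaOToPowerSeries (Set.range ι) (kobayashiLK ε Lplus Lminus))‖ ≤
      ‖PowerSeries.coeff d (iwasawaOToPowerSeries (Set.range ι) (kobayashiLK ε Lplus Lminus))‖)
    (hd2 : ∀ k : ℕ, k < d →
      ‖PowerSeries.coeff k (iwasawaOToPowerSeries (Set.range ι) (kobayashiLK ε Lplus Lminus))‖ <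
        ‖PowerSeries.coeff d (iwasawaOToPowerSeries (Set.range ι) (kobayashiLK ε Lplus Lminus))‖)
    {n : ℕ} (hpar : Even n ↔ ε = 1)
    (hroom : (if ε = 1 then cyclotomicOmegaMinus p n else cyclotomicOmegaPlus p n).natDegree + d < p ^ n) :
    ((mazurTateElementK g Ω p n).map ι).supNorm =
        ‖PowerSeries.coeff d (iwasawaOToPowerSeries (Set.range ι) (kobayashiLK ε Lplus Lminus))‖ ∧
      layerLambda ((mazurTateElementK g Ω p n).map ι) =
        (if ε = 1 then cyclotomicOmegaMinus p n else cyclotomicOmegaPlus p n).natDegree + d := by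
  set L : PowerSeries (PadicAlgCl p) := iwasawaOToPowerSeries (Set.range ι) (kobayashiLK ε Lplus Lminus) with hLdef
  set s : ℝ := ‖PowerSeries.coeff d L‖ with hsdef
  -- `L^ε ≠ 0`, so its Gauss norm `s` is positive
  have hLne : kobayashiLK ε Lplus Lminus ≠ 0 := by
    rcases Int.units_eq_one_or ε with rfl | rfl
    · rw [kobayashiLK_one]; exact hPK.2.1
    · rw [kobayashiLK_neg_one]; exact hPK.1
  have hs : 0 < s := by
    obtain ⟨k, hk⟩ : ∃ k, PowerSeries.coeff k L ≠ 0 := by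
      by_contra h
      push Not at h
      apply hLne
      apply iwasawaOToPowerSeries_injective (Set.range ι)
      rw [map_zero]
      exact PowerSeries.ext fun k ↦ by rw [← hLdef, h k, map_zero]
    exact (norm_pos_iff.mpr hk).trans_le (hd1 k)
  -- the Pollack congruence at the layer `n` (parity of `ε`)
  set D : ℕ := (if ε = 1 then cyclotomicOmegaMinus p n else cyclotomicOmegaPlus p n).natDegree with hD
  have hcong : ∃ (m : ℕ) (q : IwasawaAlgebraO (Set.range ι)),
      PowerSeries.C ((p : PadicAlgCl p) ^ m) *
          ((((mazurTateElementK g Ω p n).map ι : (PadicAlgCl p)[X]) : PowerSeries (PadicAlgCl p)) -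
            ((((-1) ^ (n / 2 + 1) * (if ε = 1 then cyclotomicOmegaMinus p n else cyclotomicOmegaPlus p n)).map
                (Int.castRingHom (PadicAlgCl p)) : (PadicAlgCl p)[X]) : PowerSeries (PadicAlgCl p)) * L) =
        (((cyclotomicOmega p n).map (Int.castRingHom (PadicAlgCl p)) : (PadicAlgCl p)[X]) :
            PowerSeries (PadicAlgCl p)) * iwasawaOToPowerSeries (Set.range ι) q := by
    rcases Int.units_eq_one_or ε with rfl | rfl
    · have heven : Even n := hpar.mpr rfl
      simp only [if_true, hLdef, kobayashiLK_one]
      exact hPK.2.2.2 n heven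
    · have hne : (-1 : ℤˣ) ≠ 1 := by decide
      have hodd : Odd n := Nat.not_even_iff_odd.mp fun h ↦ hne (hpar.mp h)
      simp only [hne, if_false, hLdef, kobayashiLK_neg_one]
      exact hPK.2.2.1 n hodd
  obtain ⟨m, q, hmq⟩ := hcong
  -- norm data of the two moduli and of `θ_n`
  obtain ⟨hωN, hω⟩ := coeff_map_cyclotomicOmega_norm p n
  obtain ⟨hωmD, hωm⟩ := coeff_map_signedOmega_norm (p := p) ε n (n / 2 + 1)
  have hc : ((p : PadicAlgCl p) ^ m) ≠ 0 := pow_ne_zero _ (by exact_mod_cast hp.out.ne_zero)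
  have hθcoeff : ∀ j, p ^ n ≤ j → ((mazurTateElementK g Ω p n).map ι).coeff j = 0 := fun j hj ↦ by
    rw [coeff_map, coeff_mazurTateElementK_eq_zero g Ω p n hj, map_zero]
  have hq : ∃ B : ℝ, ∀ k, ‖PowerSeries.coeff k (iwasawaOToPowerSeries (Set.range ι) q)‖ ≤ B :=
    ⟨1, norm_coeff_iwasawaOToPowerSeries_le_one (Set.range ι) q⟩
  have hr : (p : ℝ)⁻¹ < 1 := inv_lt_one_of_one_lt₀ (by exact_mod_cast hp.out.one_lt)
  exact supNorm_eq_and_layerLambda_eq_of_layerCongruence (N := p ^ n) (D := D) (d := d) (r := (p : ℝ)⁻¹) (s := s)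
    hr hs hc hθcoeff hωN hω hωmD hωm hd1 rfl hd2 hq hmq hroom

/-- **AN_g with `S₀ = ∅`, eventually**: for a Pollack pair of `g` over `𝒪`, a sign `ε` and the norm-`λ` datum `d` of `L^ε` there
is `n₀` (namely `2d + 2`) such that `‖θ_n(g)^ι‖_sup = ‖L^ε_d‖` and `λ_n(θ_n(g)^ι) = deg ω_n^{−ε} + d` for every `n ≥ n₀` of the
parity of `ε` (headroom from the LEAD's `natDegree_omega_add_lt_pow`: `deg ω_n^{−ε} + d < pⁿ` once `2d + 2 ≤ n`).
[cite: Pollack2003, Prop. 6.18] [cite: PollackWeston2011MT, Thm. 4.1] -/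
theorem eventually_layerLambda_mazurTateElementK_of_isPollackPairK
    {Lplus Lminus : IwasawaAlgebraO (Set.range ι)} (hPK : IsPollackPairK g ι Ω Lplus Lminus) (ε : ℤˣ) {d : ℕ}
    (hd1 : ∀ k : ℕ, ‖PowerSeries.coeff k (iwasawaOToPowerSeries (Set.range ι) (kobayashiLK ε Lplus Lminus))‖ ≤
      ‖PowerSeries.coeff d (iwasawaOToPowerSeries (Set.range ι) (kobayashiLK ε Lplus Lminus))‖)
    (hd2 : ∀ k : ℕ, k < d →
      ‖PowerSeries.coeff k (iwasawaOToPowerSeries (Set.range ι) (kobayashiLK ε Lplus Lminus))‖ <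
        ‖PowerSeries.coeff d (iwasawaOToPowerSeries (Set.range ι) (kobayashiLK ε Lplus Lminus))‖) :
    ∃ n₀ : ℕ, ∀ n ≥ n₀, (Even n ↔ ε = 1) →
      ((mazurTateElementK g Ω p n).map ι).supNorm =
          ‖PowerSeries.coeff d (iwasawaOToPowerSeries (Set.range ι) (kobayashiLK ε Lplus Lminus))‖ ∧
        layerLambda ((mazurTateElementK g Ω p n).map ι) =
          (if ε = 1 then cyclotomicOmegaMinus p n else cyclotomicOmegaPlus p n).natDegree + d :=
  ⟨2 * d + 2, fun _ hn hpar ↦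
    supNorm_eq_and_layerLambda_mazurTateElementK_of_isPollackPairK g ι Ω hPK ε hd1 hd2 hpar
      (natDegree_omega_add_lt_pow hn ε)⟩

end Core

/-! ## §3 Unit content supplies the norm-`λ` datum with Gauss norm `1` -/

section UnitContent

/-- **Unit content ⇒ norm-`λ` datum.** If `L ∈ 𝒪⟦T⟧` (`𝒪 = padicCoeffIntegers S ⊆ ℚ̄_p`) has unit content (`HasUnitContent L`:
some coefficient is a unit of `𝒪`, i.e. `μ(L) = 0`), then there is an index `d` with `‖L_d‖ = 1`, `‖L_k‖ ≤ ‖L_d‖` for all `k`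
and `‖L_k‖ < ‖L_d‖` for `k < d` (the least index of a unit coefficient; all coefficients of `𝒪⟦T⟧` have norm `≤ 1`).
[cite: EmertonPollackWeston2005, Def. 4.4.1 and the remark after Lemma 4.4.3] [cite: PollackWeston2011MT, §3.1] -/
theorem exists_normLambda_of_hasUnitContent {S : Set (PadicAlgCl p)} {L : IwasawaAlgebraO S}
    (hL : HasUnitContent L) :
    ∃ d : ℕ, ‖PowerSeries.coeff d (iwasawaOToPowerSeries S L)‖ = 1 ∧
      (∀ k : ℕ, ‖PowerSeries.coeff k (iwasawaOToPowerSeries S L)‖ ≤ ‖PowerSeries.coeff d (iwasawaOToPowerSeries S L)‖) ∧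
      (∀ k : ℕ, k < d →
        ‖PowerSeries.coeff k (iwasawaOToPowerSeries S L)‖ < ‖PowerSeries.coeff d (iwasawaOToPowerSeries S L)‖) := by
  -- a unit of `𝒪` has norm `1`
  have hunit : ∀ {x : padicCoeffIntegers S}, IsUnit x → ‖(x : PadicAlgCl p)‖ = 1 := by
    intro x hx
    obtain ⟨y, hy⟩ := hx.exists_right_inv
    have h1 : ‖(x : PadicAlgCl p)‖ * ‖((y : padicCoeffIntegers S) : PadicAlgCl p)‖ = 1 := by
      rw [← norm_mul, ← Subring.coe_mul, hy, Subring.coe_one, norm_one]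
    refine le_antisymm x.2.2 ?_
    by_contra hlt
    push Not at hlt
    have : ‖(x : PadicAlgCl p)‖ * ‖((y : padicCoeffIntegers S) : PadicAlgCl p)‖ < 1 :=
      mul_lt_one_of_nonneg_of_lt_one_left (norm_nonneg _) hlt y.2.2
    exact this.ne h1
  have hex : ∃ d : ℕ, ‖PowerSeries.coeff d (iwasawaOToPowerSeries S L)‖ = 1 := by
    obtain ⟨n, hn⟩ := hL
    exact ⟨n, by rw [coeff_iwasawaOToPowerSeries]; exact hunit hn⟩
  refine ⟨Nat.find hex, Nat.find_spec hex, fun k ↦ ?_, fun k hk ↦ ?_⟩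
  · rw [Nat.find_spec hex]
    exact norm_coeff_iwasawaOToPowerSeries_le_one S L k
  · rw [Nat.find_spec hex]
    exact lt_of_le_of_ne (norm_coeff_iwasawaOToPowerSeries_le_one S L k) (Nat.find_min hex hk)

end UnitContent

/-! ## §4 The same law from ONE congruence (no Pollack pair, no non-vanishing input)

For the engine ENG_T2 the partner's signed functions come from the tree's CONSTRUCTION at a cohomological period
(`ResidualThetaLayer.exists_isCongrModOmegaO_even/odd`, Pollack Prop. 6.18 over `𝒪`, every prime, congruence half only —
the non-vanishing half is Rohrlich). The layer law needs only the congruence at the layer in question and a norm-`λ` datum with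
POSITIVE Gauss norm (for ENG_T2 positivity is forced by Kan₂ + AN_W), so we record that form too. -/

section Congruence

variable {M : ℕ} (g : CuspForm (CongruenceSubgroup.Gamma0 M) 2) (ι : coeffField g →+* PadicAlgCl p) (Ω : ℂ)

/-- **`‖θ_n(g)^ι‖_sup = s` and `λ_n(θ_n(g)^ι) = deg ω_n^{−ε} + d` from ONE congruence.** If
`θ_n(g)^ι ≡ (−1)^{⌊n/2⌋+1} ω_n^{−ε}·L (mod ω_n)` in `𝒪⟦T⟧ ⊗ ℚ` (`IsCongrModOmegaO`, e.g. from
`ResidualThetaLayer.exists_isCongrModOmegaO_even/odd` at a cohomological period) for some `L ∈ 𝒪⟦T⟧` whose Gauss norm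
`s = ‖L_d‖ > 0` is first attained at the index `d`, and `deg ω_n^{−ε} + d < pⁿ`, then `θ_n(g)^ι` has sup norm `s` and layer-`λ`
`deg ω_n^{−ε} + d`. No parity and no non-vanishing hypothesis (the congruence is the input; `s > 0` replaces `L ≠ 0`).
[cite: Pollack2003, Prop. 6.18 and Prop. 6.9] [cite: PollackWeston2011MT, §3.1 and Thm. 4.1] -/
theorem supNorm_eq_and_layerLambda_mazurTateElementK_of_isCongrModOmegaO (ε : ℤˣ) {n : ℕ}
    {L : IwasawaAlgebraO (Set.range ι)}
    (hcong : IsCongrModOmegaO (Set.range ι) n ((mazurTateElementK g Ω p n).map ι)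
      (((((-1) ^ (n / 2 + 1) * (if ε = 1 then cyclotomicOmegaMinus p n else cyclotomicOmegaPlus p n)).map
          (Int.castRingHom (PadicAlgCl p)) : (PadicAlgCl p)[X]) : PowerSeries (PadicAlgCl p)) *
        iwasawaOToPowerSeries (Set.range ι) L))
    {d : ℕ} (hs : 0 < ‖PowerSeries.coeff d (iwasawaOToPowerSeries (Set.range ι) L)‖)
    (hd1 : ∀ k : ℕ, ‖PowerSeries.coeff k (iwasawaOToPowerSeries (Set.range ι) L)‖ ≤
      ‖PowerSeries.coeff d (iwasawaOToPowerSeries (Set.range ι) L)‖)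
    (hd2 : ∀ k : ℕ, k < d →
      ‖PowerSeries.coeff k (iwasawaOToPowerSeries (Set.range ι) L)‖ <
        ‖PowerSeries.coeff d (iwasawaOToPowerSeries (Set.range ι) L)‖)
    (hroom : (if ε = 1 then cyclotomicOmegaMinus p n else cyclotomicOmegaPlus p n).natDegree + d < p ^ n) :
    ((mazurTateElementK g Ω p n).map ι).supNorm = ‖PowerSeries.coeff d (iwasawaOToPowerSeries (Set.range ι) L)‖ ∧
      layerLambda ((mazurTateElementK g Ω p n).map ι) =
        (if ε = 1 then cyclotomicOmegaMinus p n else cyclotomicOmegaPlus p n).natDegree + d := by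
  obtain ⟨m, q, hmq⟩ := hcong
  obtain ⟨hωN, hω⟩ := coeff_map_cyclotomicOmega_norm p n
  obtain ⟨hωmD, hωm⟩ := coeff_map_signedOmega_norm (p := p) ε n (n / 2 + 1)
  have hc : ((p : PadicAlgCl p) ^ m) ≠ 0 := pow_ne_zero _ (by exact_mod_cast hp.out.ne_zero)
  have hθcoeff : ∀ j, p ^ n ≤ j → ((mazurTateElementK g Ω p n).map ι).coeff j = 0 := fun j hj ↦ by
    rw [coeff_map, coeff_mazurTateElementK_eq_zero g Ω p n hj, map_zero]
  have hq : ∃ B : ℝ, ∀ k, ‖PowerSeries.coeff k (iwasawaOToPowerSeries (Set.range ι) q)‖ ≤ B :=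
    ⟨1, norm_coeff_iwasawaOToPowerSeries_le_one (Set.range ι) q⟩
  have hr : (p : ℝ)⁻¹ < 1 := inv_lt_one_of_one_lt₀ (by exact_mod_cast hp.out.one_lt)
  exact supNorm_eq_and_layerLambda_eq_of_layerCongruence (N := p ^ n)
    (D := (if ε = 1 then cyclotomicOmegaMinus p n else cyclotomicOmegaPlus p n).natDegree) (d := d)
    (r := (p : ℝ)⁻¹) (s := ‖PowerSeries.coeff d (iwasawaOToPowerSeries (Set.range ι) L)‖)
    hr hs hc hθcoeff hωN hω hωmD hωm hd1 rfl hd2 hq hmq hroom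

/-- **The congruence-family form, eventually**: if the congruences `θ_n(g)^ι ≡ (−1)^{⌊n/2⌋+1} ω_n^{−ε}·L (mod ω_n)` hold at every
layer `n` of the parity of `ε` (as produced by `ResidualThetaLayer.exists_isCongrModOmegaO_even` for `ε = 1`, `_odd` for `ε = −1`),
then for every `n ≥ 2d + 2` of that parity `‖θ_n(g)^ι‖_sup = ‖L_d‖` and `λ_n(θ_n(g)^ι) = deg ω_n^{−ε} + d`.
[cite: Pollack2003, Prop. 6.18] [cite: PollackWeston2011MT, Thm. 4.1] -/
theorem eventually_layerLambda_mazurTateElementK_of_isCongrModOmegaO (ε : ℤˣ)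
    {L : IwasawaAlgebraO (Set.range ι)}
    (hcong : ∀ n : ℕ, (Even n ↔ ε = 1) → IsCongrModOmegaO (Set.range ι) n ((mazurTateElementK g Ω p n).map ι)
      (((((-1) ^ (n / 2 + 1) * (if ε = 1 then cyclotomicOmegaMinus p n else cyclotomicOmegaPlus p n)).map
          (Int.castRingHom (PadicAlgCl p)) : (PadicAlgCl p)[X]) : PowerSeries (PadicAlgCl p)) *
        iwasawaOToPowerSeries (Set.range ι) L))
    {d : ℕ} (hs : 0 < ‖PowerSeries.coeff d (iwasawaOToPowerSeries (Set.range ι) L)‖)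
    (hd1 : ∀ k : ℕ, ‖PowerSeries.coeff k (iwasawaOToPowerSeries (Set.range ι) L)‖ ≤
      ‖PowerSeries.coeff d (iwasawaOToPowerSeries (Set.range ι) L)‖)
    (hd2 : ∀ k : ℕ, k < d →
      ‖PowerSeries.coeff k (iwasawaOToPowerSeries (Set.range ι) L)‖ <
        ‖PowerSeries.coeff d (iwasawaOToPowerSeries (Set.range ι) L)‖) :
    ∃ n₀ : ℕ, ∀ n ≥ n₀, (Even n ↔ ε = 1) →
      ((mazurTateElementK g Ω p n).map ι).supNorm = ‖PowerSeries.coeff d (iwasawaOToPowerSeries (Set.range ι) L)‖ ∧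
        layerLambda ((mazurTateElementK g Ω p n).map ι) =
          (if ε = 1 then cyclotomicOmegaMinus p n else cyclotomicOmegaPlus p n).natDegree + d :=
  ⟨2 * d + 2, fun n hn hpar ↦
    supNorm_eq_and_layerLambda_mazurTateElementK_of_isCongrModOmegaO g ι Ω ε (hcong n hpar) hs hd1 hd2
      (natDegree_omega_add_lt_pow hn ε)⟩

end Congruence

end Summit.BirchSwinnertonDyer.BirchSwinnertonDyer.Theorems.SmallImageRttLayerLawK

end
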